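import Summits.Ventures.PercRepro.C025ProfileFourCapEBasis
import Summits.Ventures.PercRepro.C025ProfileFourCapESmall
/-!
# (Cap) OF RULE E — `|S| ≥ 6` (night-3 g10)
NIGHT3-G10-CAPE-PROOF.md §3. On a rank-`4` set `S` with at least six points only FAT sets pay (a pair has `≥ 4`
points of `S` outside it), and a paying fat `B` has `S ∖ B ⊆ F_B` (no point of `S ∖ B` on its line). Two different
paying fat sets meet in at most one point (`inter_le_one_of_pay`), so `|B| + |B′| ≤ |S|` (`card_add_card_le_of_inter_le_one`):
then `|S| = 6`, both are `3`-point lines through a common point, and each has `|F_B| ≥ R − 1` (the other line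
gives a parallel pair of `M／B`), whence each pays at most `1/2` (`wE_le_half_of_pay_pair`). A single paying fat set
pays at most `C(R,2)/(6·C(R−2,2)) ≤ 5/9` (`wE_fat_le_five_ninths`); three paying fat sets are impossible
(`not_three_lines_of_card_six`). Result: `capE_sum_of_six_le`.
-/
open scoped Matroid
namespace PercRepro
open Set Finset ThmH
section CapEBig
variable {α : Type} [DecidableEq α] {M : Matroid α} [M.Finite]

/-- A fat set pays at most `(R(R−1)/12) / N` for any `0 < N ≤ |G_B|`. -/
theorem wE_fat_le_of_le_card_Gfam {R : ℕ} (hR : M.eRank = R) (h5R : 5 ≤ R) {B : Finset α}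
    (hB : B ∈ Profile.Rq M 2) (hBc : B.card ≠ 2) (S : Finset α) {N : ℕ} (hN : N ≤ (Gfam M B).card)
    (hNpos : 0 < N) : wE M B S ≤ ((R : ℚ) * ((R : ℚ) - 1) / 12) / (N : ℚ) := by
  have hR5 : (5 : ℕ∞) ≤ M.eRank := by rw [hR]; exact_mod_cast h5R
  refine (wE_fat_le hR5 hB hBc S).trans ?_
  have hp := price_nonneg' (M := M) B
  have hNq : (0 : ℚ) < N := by exact_mod_cast hNpos
  have hNG : (N : ℚ) ≤ ((Gfam M B).card : ℚ) := by exact_mod_cast hN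
  calc Profile.price M 2 4 B / ((Gfam M B).card : ℚ) ≤ Profile.price M 2 4 B / (N : ℚ) :=
        div_le_div_of_nonneg_left hp hNq hNG
    _ ≤ ((R : ℚ) * ((R : ℚ) - 1) / 12) / (N : ℚ) := by
        apply div_le_div_of_nonneg_right _ hNq.le
        rw [price_two_four_eq]
        have hcR : crk M B ≤ R := crk_le_eRank hR B
        have hcRq : (crk M B : ℚ) ≤ R := by exact_mod_cast hcR
        split_ifs with h4
        · have h4q : (4 : ℚ) ≤ crk M B := by exact_mod_cast h4
          nlinarith
        · have : (4 : ℚ) ≤ R := by exact_mod_cast (show 4 ≤ R by omega)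
          nlinarith

/-- A paying fat set has every point of `S ∖ B` outside its line. -/
theorem sdiff_subset_Fs_of_pay {B S : Finset α} (hBc : B.card ≠ 2) (hne : wE M B S ≠ 0) : S \ B ⊆ Fs M B := by
  unfold wE at hne
  by_cases h1 : crk M B < 4
  · rw [if_pos h1] at hne; exact absurd rfl hne
  rw [if_neg h1, if_neg hBc] at hne
  by_cases h2 : S \ B ∈ Gfam M B ∪ Pfam M B
  · rw [Finset.mem_union] at h2
    rcases h2 with h2 | h2
    · exact (mem_Gfam.1 h2).1
    · exact (mem_Pfam.1 h2).1
  · rw [if_neg h2] at hne; exact absurd rfl hne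

/-- A paying set has two or three points of `S` outside it. -/
theorem card_sdiff_of_pay {B S : Finset α} (hne : wE M B S ≠ 0) : (S \ B).card = 2 ∨ (S \ B).card = 3 := by
  by_contra h
  push Not at h
  exact hne (wE_eq_zero_of_card_sdiff h.1 h.2)

/-- Two different paying fat subsets of `S` share at most one point. -/
theorem inter_le_one_of_pay (hsimple : ∀ T ⊆ M.E, T.encard ≤ 2 → M.Indep T) {S B B' : Finset α}
    (hB : B ∈ Profile.Rq M 2) (hB' : B' ∈ Profile.Rq M 2) (hBS : B ⊆ S) (hB'S : B' ⊆ S)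
    (hBc : B.card ≠ 2) (hB'c : B'.card ≠ 2) (hne : wE M B S ≠ 0) (hne' : wE M B' S ≠ 0) (hBB' : B ≠ B') :
    (B ∩ B').card ≤ 1 := by
  obtain ⟨hBg, hB2⟩ := Profile.mem_Rq.1 hB
  obtain ⟨hB'g, hB'2⟩ := Profile.mem_Rq.1 hB'
  by_contra hlt
  push Not at hlt
  have h1 : B' ⊆ clF M B := subset_clF_of_two_le_card_inter hsimple hBg hB'g hB2 hB'2 (by omega)
  have h2 : B ⊆ clF M B' := subset_clF_of_two_le_card_inter hsimple hB'g hBg hB'2 hB2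
    (by rw [Finset.inter_comm]; omega)
  have hF := sdiff_subset_Fs_of_pay hBc hne
  have hF' := sdiff_subset_Fs_of_pay hB'c hne'
  apply hBB'
  apply Finset.Subset.antisymm
  · intro x hx
    by_contra hx'
    have : x ∈ S \ B' := Finset.mem_sdiff.2 ⟨hBS hx, hx'⟩
    exact (mem_Fs.1 (hF' this)).2 (h2 hx)
  · intro x hx
    by_contra hx'
    have : x ∈ S \ B := Finset.mem_sdiff.2 ⟨hB'S hx, hx'⟩
    exact (mem_Fs.1 (hF this)).2 (h1 hx)

/-- Two different paying fat subsets of a rank-`4` set with `≥ 6` points: `|S| = 6` and both have three points. -/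
theorem card_eq_three_of_two_pay (hsimple : ∀ T ⊆ M.E, T.encard ≤ 2 → M.Indep T) {S B B' : Finset α}
    (hS : S ∈ Shadow.levelSet M 4) (h6 : 6 ≤ S.card)
    (hB : B ∈ Profile.Rq M 2) (hB' : B' ∈ Profile.Rq M 2) (hBS : B ⊆ S) (hB'S : B' ⊆ S)
    (hBc : B.card ≠ 2) (hB'c : B'.card ≠ 2) (hne : wE M B S ≠ 0) (hne' : wE M B' S ≠ 0) (hBB' : B ≠ B') :
    S.card = 6 ∧ B.card = 3 ∧ B'.card = 3 ∧ (B ∩ B').card ≤ 1 := by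
  obtain ⟨hSg, hS4⟩ := Profile.mem_levelSet.1 hS
  obtain ⟨hBg, hB2⟩ := Profile.mem_Rq.1 hB
  obtain ⟨hB'g, hB'2⟩ := Profile.mem_Rq.1 hB'
  have hint := inter_le_one_of_pay hsimple hB hB' hBS hB'S hBc hB'c hne hne' hBB'
  have hsum := card_add_card_le_of_inter_le_one hsimple hSg hS4 hBS hB'S hB2 hB'2 hint
  have hc := card_sdiff_of_pay hne
  have hc' := card_sdiff_of_pay hne'
  rw [Finset.card_sdiff_of_subset hBS] at hc
  rw [Finset.card_sdiff_of_subset hB'S] at hc'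
  have hle := Finset.card_le_card hBS
  have hle' := Finset.card_le_card hB'S
  refine ⟨by omega, by omega, by omega, hint⟩

/-- `ρ(B ∪ B′) ≤ 3` for two rank-`2` sets with a common point (simple matroid). -/
theorem eRk_union_le_three_of_inter (hsimple : ∀ T ⊆ M.E, T.encard ≤ 2 → M.Indep T) {B B' : Finset α}
    (hBg : B ⊆ gr M) (hB2 : M.eRk (B : Set α) = 2) (hB'2 : M.eRk (B' : Set α) = 2) {p : α} (hp : p ∈ B ∩ B') :
    M.eRk ((B ∪ B' : Finset α) : Set α) ≤ 3 := by
  have h := M.eRk_inter_add_eRk_union_le (B : Set α) (B' : Set α)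
  rw [← Finset.coe_inter, ← Finset.coe_union, hB2, hB'2] at h
  have hp1 : (1 : ℕ∞) ≤ M.eRk ((B ∩ B' : Finset α) : Set α) := by
    have := eRk_singleton_eq_one_of_simple hsimple (hBg (Finset.mem_inter.1 hp).1)
    rw [← this]
    apply M.eRk_mono
    rw [Set.singleton_subset_iff, Finset.mem_coe]; exact hp
  have hfin : M.eRk ((B ∪ B' : Finset α) : Set α) ≠ ⊤ := (M.isRkFinite_set _).eRk_lt_top.ne
  obtain ⟨n, hn⟩ := ENat.ne_top_iff_exists.1 hfin
  have hfin' : M.eRk ((B ∩ B' : Finset α) : Set α) ≠ ⊤ := (M.isRkFinite_set _).eRk_lt_top.ne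
  obtain ⟨m, hm⟩ := ENat.ne_top_iff_exists.1 hfin'
  rw [← hn, ← hm] at h
  rw [← hm] at hp1
  rw [← hn]
  have h' : m + n ≤ 4 := by exact_mod_cast h
  have hp1' : 1 ≤ m := by exact_mod_cast hp1
  exact_mod_cast (show n ≤ 3 by omega)

/-- **The other line gives a parallel pair**: if `B, B′ ⊆ S` are paying `3`-point lines of the six-point rank-`4` set `S`
with at most one common point, then `|F_B| ≥ R − 1`. -/
theorem card_Fs_ge_of_two_pay {R : ℕ} (hR : M.eRank = R) (hsimple : ∀ T ⊆ M.E, T.encard ≤ 2 → M.Indep T)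
    {S B B' : Finset α} (hS : S ∈ Shadow.levelSet M 4) (h6 : S.card = 6)
    (hB : B ∈ Profile.Rq M 2) (hB' : B' ∈ Profile.Rq M 2) (hBS : B ⊆ S) (hB'S : B' ⊆ S)
    (hBc : B.card = 3) (hB'c : B'.card = 3) (hint : (B ∩ B').card ≤ 1) (hne : wE M B S ≠ 0) :
    R - 1 ≤ (Fs M B).card := by
  obtain ⟨hSg, hS4⟩ := Profile.mem_levelSet.1 hS
  obtain ⟨hBg, hB2⟩ := Profile.mem_Rq.1 hB
  obtain ⟨hB'g, hB'2⟩ := Profile.mem_Rq.1 hB'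
  have hF := sdiff_subset_Fs_of_pay (by omega) hne
  -- `B` and `B′` are not disjoint
  have hnd : (B ∩ B').card = 1 := by
    by_contra h0
    have h0' : (B ∩ B').card = 0 := by omega
    rw [Finset.card_eq_zero] at h0'
    have hdisj : Disjoint B B' := Finset.disjoint_iff_inter_eq_empty.2 h0'
    -- then `B′ = S ∖ B ∈ P_B`: a parallel pair `Y ⊆ B′` of `M／B` puts `S` inside the plane `cl(B ∪ Y)`
    have hB'eq : B' = S \ B := by
      apply Finset.eq_of_subset_of_card_le
      · intro x hx; exact Finset.mem_sdiff.2 ⟨hB'S hx, Finset.disjoint_right.1 hdisj hx⟩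
      · rw [Finset.card_sdiff_of_subset hBS, h6, hBc, hB'c]
    have hP : S \ B ∈ Pfam M B := by
      have h' := hne
      unfold wE at h'
      by_cases h1 : crk M B < 4
      · rw [if_pos h1] at h'; exact absurd rfl h'
      rw [if_neg h1, if_neg (by omega)] at h'
      by_cases h2 : S \ B ∈ Gfam M B ∪ Pfam M B
      · rw [Finset.mem_union] at h2
        rcases h2 with h2 | h2
        · have := card_eq_two_of_mem_Gfam h2
          rw [Finset.card_sdiff_of_subset hBS, h6, hBc] at this
          omega
        · exact h2
      · rw [if_neg h2] at h'; exact absurd rfl h'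
    obtain ⟨_, _, _, Y, hYB', hYc, hY3⟩ := mem_Pfam.1 hP
    rw [← hB'eq] at hYB'
    have hBYg : B ∪ Y ⊆ gr M := Finset.union_subset hBg ((hYB'.trans hB'S).trans hSg)
    have hBYE : ((B ∪ Y : Finset α) : Set α) ⊆ M.E := by rw [← coe_gr]; exact_mod_cast hBYg
    -- `B′ ⊆ cl Y ⊆ cl (B ∪ Y)`
    have hYB'cl : B' ⊆ clF M Y := by
      obtain ⟨y, y', hyy', rfl⟩ := Finset.card_eq_two.1 hYc
      have := clF_pair_eq_of_subset_line hsimple hB'g hB'2 hyy' (hYB' (Finset.mem_insert_self _ _))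
        (hYB' (Finset.mem_insert_of_mem (Finset.mem_singleton_self _)))
      rw [this]; exact subset_clF_self hB'g
    have hB'cl : (B' : Set α) ⊆ M.closure ((B ∪ Y : Finset α) : Set α) := by
      have h1 : (B' : Set α) ⊆ M.closure (Y : Set α) := by
        rw [← coe_clF]; exact_mod_cast hYB'cl
      refine h1.trans (M.closure_subset_closure ?_)
      rw [Finset.coe_union]; exact Set.subset_union_right
    have hScl : (S : Set α) ⊆ M.closure ((B ∪ Y : Finset α) : Set α) := by
      intro x hx
      rw [Finset.mem_coe] at hx
      by_cases hxB : x ∈ B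
      · exact M.subset_closure _ hBYE (by rw [Finset.mem_coe]; exact Finset.mem_union_left _ hxB)
      · have hxB' : x ∈ B' := by rw [hB'eq]; exact Finset.mem_sdiff.2 ⟨hx, hxB⟩
        exact hB'cl (by exact_mod_cast hxB')
    have := M.eRk_mono hScl
    rw [M.eRk_closure_eq, hY3, hS4] at this
    norm_num at this
  obtain ⟨p, hp⟩ := Finset.card_eq_one.1 hnd
  have hpB : p ∈ B ∩ B' := by rw [hp]; exact Finset.mem_singleton_self _
  -- `Y := B′ ∖ B` is a parallel pair of `M／B`
  have hYc : (B' \ B).card = 2 := by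
    rw [Finset.card_sdiff, hnd, hB'c]
  have hY3 : M.eRk ((B ∪ (B' \ B) : Finset α) : Set α) = 3 := by
    have hu : B ∪ (B' \ B) = B ∪ B' := Finset.union_sdiff_self_eq_union
    rw [hu]
    apply le_antisymm (eRk_union_le_three_of_inter hsimple hBg hB2 hB'2 hpB)
    obtain ⟨y, hy⟩ : ∃ y, y ∈ B' \ B := Finset.card_pos.1 (by omega)
    have hyF : y ∈ Fs M B := hF (Finset.mem_sdiff.2 ⟨hB'S (Finset.mem_sdiff.1 hy).1, (Finset.mem_sdiff.1 hy).2⟩)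
    have h3 := eRk_insert_Fs_eq_three hB2 hyF
    rw [← h3]
    apply M.eRk_mono
    intro x hx
    rw [Finset.coe_insert, Set.mem_insert_iff, Finset.mem_coe] at hx
    rw [Finset.coe_union, Set.mem_union, Finset.mem_coe, Finset.mem_coe]
    rcases hx with rfl | hx
    · exact Or.inr (Finset.mem_sdiff.1 hy).1
    · exact Or.inl hx
  -- the two points of `Y` lie in `F_B`; removing one of them keeps `B ∪ F_B` spanning
  obtain ⟨y, y', hyy', hY⟩ := Finset.card_eq_two.1 hYc
  have hyF : y ∈ Fs M B := hF (by
    have : y ∈ B' \ B := by rw [hY]; exact Finset.mem_insert_self _ _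
    rw [Finset.mem_sdiff] at this ⊢; exact ⟨hB'S this.1, this.2⟩)
  have hy'F : y' ∈ Fs M B := hF (by
    have : y' ∈ B' \ B := by rw [hY]; exact Finset.mem_insert_of_mem (Finset.mem_singleton_self _)
    rw [Finset.mem_sdiff] at this ⊢; exact ⟨hB'S this.1, this.2⟩)
  -- `y′ ∈ cl(B ∪ y)` (ρ(B ∪ {y, y′}) = 3 = ρ(B ∪ y))
  have hy'cl : y' ∈ M.closure ((insert y B : Finset α) : Set α) := by
    rw [hY] at hY3
    exact mem_closure_insert_of_eRk_pair_eq_three hB2 hyF (Fs_subset_gr B hy'F) hY3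
  -- `E ⊆ cl(B ∪ (F_B ∖ y′))`
  have hspan : M.eRank ≤ M.eRk ((B ∪ (Fs M B).erase y' : Finset α) : Set α) := by
    rw [M.eRank_def, ← M.eRk_closure_eq ((B ∪ (Fs M B).erase y' : Finset α) : Set α)]
    apply M.eRk_mono
    intro x hx
    have hxg : x ∈ gr M := by rw [← Finset.mem_coe, coe_gr]; exact hx
    have hEsub : ((B ∪ (Fs M B).erase y' : Finset α) : Set α) ⊆ M.E := by
      rw [← coe_gr]
      exact_mod_cast Finset.union_subset hBg ((Finset.erase_subset _ _).trans (Fs_subset_gr B))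
    by_cases hcl : x ∈ clF M B
    · have h1 : x ∈ M.closure (B : Set α) := by rw [← coe_clF]; exact_mod_cast hcl
      exact M.closure_subset_closure (by rw [Finset.coe_union]; exact Set.subset_union_left) h1
    · have hxF : x ∈ Fs M B := mem_Fs.2 ⟨hxg, hcl⟩
      by_cases hxy' : x = y'
      · subst hxy'
        refine M.closure_subset_closure ?_ hy'cl
        intro w hw
        rw [Finset.coe_insert, Set.mem_insert_iff, Finset.mem_coe] at hw
        rw [Finset.coe_union, Set.mem_union, Finset.mem_coe, Finset.mem_coe, Finset.mem_erase]
        rcases hw with rfl | hw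
        · exact Or.inr ⟨hyy', hyF⟩
        · exact Or.inl hw
      · exact M.subset_closure _ hEsub (by
          rw [Finset.mem_coe, Finset.mem_union, Finset.mem_erase]; exact Or.inr ⟨hxy', hxF⟩)
  have hcard : M.eRk ((B ∪ (Fs M B).erase y' : Finset α) : Set α) ≤ ((B.card + ((Fs M B).erase y').card : ℕ) : ℕ∞) := by
    refine (eRk_le_card _).trans ?_
    exact_mod_cast Finset.card_union_le _ _
  rw [hR] at hspan
  have h := hspan.trans hcard
  have h' : R ≤ B.card + ((Fs M B).erase y').card := by exact_mod_cast h
  rw [Finset.card_erase_of_mem hy'F, hBc] at h'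
  -- `ρ(B ∪ X) ≤ 2 + |X|`, not `3 + |X|`: use the rank of `B` instead of its cardinality
  have hspan2 : M.eRk ((B ∪ (Fs M B).erase y' : Finset α) : Set α) ≤ (2 : ℕ∞) + (((Fs M B).erase y').card : ℕ) := by
    rw [Finset.coe_union]
    refine (M.eRk_union_le_eRk_add_eRk _ _).trans ?_
    rw [hB2]
    have := eRk_le_card (M := M) ((Fs M B).erase y')
    exact add_le_add_right this _
  have h2 := hspan.trans hspan2
  have h2' : R ≤ 2 + ((Fs M B).erase y').card := by exact_mod_cast h2
  rw [Finset.card_erase_of_mem hy'F] at h2'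
  have hpos : 0 < (Fs M B).card := Finset.card_pos.2 ⟨y', hy'F⟩
  omega

/-- A paying `3`-point line of a six-point rank-`4` set that meets another paying line pays at most `1/2`. -/
theorem wE_le_half_of_two_pay {R : ℕ} (hR : M.eRank = R) (h5R : 5 ≤ R)
    (hsimple : ∀ T ⊆ M.E, T.encard ≤ 2 → M.Indep T) {S B B' : Finset α} (hS : S ∈ Shadow.levelSet M 4)
    (h6 : S.card = 6) (hB : B ∈ Profile.Rq M 2) (hB' : B' ∈ Profile.Rq M 2) (hBS : B ⊆ S) (hB'S : B' ⊆ S)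
    (hBc : B.card = 3) (hB'c : B'.card = 3) (hint : (B ∩ B').card ≤ 1) (hne : wE M B S ≠ 0) :
    wE M B S ≤ 1 / 2 := by
  have hf := card_Fs_ge_of_two_pay hR hsimple hS h6 hB hB' hBS hB'S hBc hB'c hint hne
  have hG := card_Gfam_ge hR hB
  have hN : Nat.choose (R - 2) 2 + (R - 3) ≤ (Gfam M B).card := by
    refine le_trans ?_ hG
    have : 1 ≤ (Fs M B).card - (R - 2) := by omega
    nlinarith
  have hNpos : 0 < Nat.choose (R - 2) 2 + (R - 3) := by omega
  refine (wE_fat_le_of_le_card_Gfam hR h5R hB (by omega) S hN hNpos).trans ?_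
  have hNq : ((Nat.choose (R - 2) 2 + (R - 3) : ℕ) : ℚ) = ((R : ℚ) - 3) * ((R : ℚ) - 2) / 2 + ((R : ℚ) - 3) := by
    rw [Nat.cast_add, Nat.cast_choose_two, Nat.cast_sub (by omega), Nat.cast_sub (by omega)]
    push_cast; ring
  rw [hNq, div_le_iff₀ (by
    have : (5 : ℚ) ≤ R := by exact_mod_cast h5R
    nlinarith)]
  have : (5 : ℚ) ≤ R := by exact_mod_cast h5R
  nlinarith

/-- A paying fat set pays at most `5/9` (`N_B ≥ C(R−2, 2)`). -/
theorem wE_fat_le_five_ninths {R : ℕ} (hR : M.eRank = R) (h5R : 5 ≤ R) {B : Finset α}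
    (hB : B ∈ Profile.Rq M 2) (hBc : B.card ≠ 2) (S : Finset α) : wE M B S ≤ 5 / 9 := by
  have hG := card_Gfam_ge hR hB
  have hN : Nat.choose (R - 2) 2 ≤ (Gfam M B).card := le_trans (Nat.le_add_right _ _) hG
  have hNpos : 0 < Nat.choose (R - 2) 2 := Nat.choose_pos (by omega)
  refine (wE_fat_le_of_le_card_Gfam hR h5R hB hBc S hN hNpos).trans ?_
  have hNq : ((Nat.choose (R - 2) 2 : ℕ) : ℚ) = ((R : ℚ) - 3) * ((R : ℚ) - 2) / 2 := by
    rw [Nat.cast_choose_two, Nat.cast_sub (by omega)]; push_cast; ring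
  rw [hNq, div_le_iff₀ (by
    have : (5 : ℚ) ≤ R := by exact_mod_cast h5R
    nlinarith)]
  have : (5 : ℚ) ≤ R := by exact_mod_cast h5R
  nlinarith

/-- **(Cap) on a rank-`4` set with at least six points.** -/
theorem capE_sum_of_six_le {R : ℕ} (hR : M.eRank = R) (h5R : 5 ≤ R)
    (hsimple : ∀ T ⊆ M.E, T.encard ≤ 2 → M.Indep T) {S : Finset α} (hS : S ∈ Shadow.levelSet M 4)
    (h6 : 6 ≤ S.card) : ∑ B ∈ (Profile.Rq M 2).filter (fun B => B ⊆ S), wE M B S ≤ 1 := by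
  obtain ⟨hSg, hS4⟩ := Profile.mem_levelSet.1 hS
  set F := (Profile.Rq M 2).filter (fun B => B ⊆ S) with hF
  set Pay := F.filter (fun B => wE M B S ≠ 0) with hPay
  have hsum : ∑ B ∈ F, wE M B S = ∑ B ∈ Pay, wE M B S := by
    rw [hPay, Finset.sum_filter_ne_zero]
  rw [hsum]
  -- every paying set is fat
  have hfat : ∀ B ∈ Pay, B ∈ Profile.Rq M 2 ∧ B ⊆ S ∧ B.card ≠ 2 ∧ wE M B S ≠ 0 := by
    intro B hB
    rw [hPay, Finset.mem_filter, hF, Finset.mem_filter] at hB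
    refine ⟨hB.1.1, hB.1.2, ?_, hB.2⟩
    intro h2
    apply hB.2
    apply wE_eq_zero_of_card_sdiff <;> rw [Finset.card_sdiff_of_subset hB.1.2, h2] <;> omega
  -- at most two paying sets
  have hcard : Pay.card ≤ 2 := by
    by_contra hlt
    push Not at hlt
    obtain ⟨B₁, h1, B₂, h2, B₃, h3, h12, h13, h23⟩ := Finset.two_lt_card.1 hlt
    obtain ⟨hB1, h1S, h1c, h1ne⟩ := hfat B₁ h1
    obtain ⟨hB2, h2S, h2c, h2ne⟩ := hfat B₂ h2
    obtain ⟨hB3, h3S, h3c, h3ne⟩ := hfat B₃ h3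
    obtain ⟨hS6, h1c3, h2c3, hi12⟩ := card_eq_three_of_two_pay hsimple hS h6 hB1 hB2 h1S h2S h1c h2c h1ne h2ne h12
    obtain ⟨_, h3c3, _, hi31⟩ := card_eq_three_of_two_pay hsimple hS h6 hB3 hB1 h3S h1S h3c h1c h3ne h1ne h13.symm
    obtain ⟨_, _, _, hi32⟩ := card_eq_three_of_two_pay hsimple hS h6 hB3 hB2 h3S h2S h3c h2c h3ne h2ne h23.symm
    exact not_three_lines_of_card_six hsimple hSg hS4 hS6 h1S h2S h3S (Profile.mem_Rq.1 hB1).2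
      (Profile.mem_Rq.1 hB2).2 (Profile.mem_Rq.1 hB3).2 h1c3 h2c3 h3c3 hi12 hi31 hi32
  rcases Nat.lt_or_ge Pay.card 2 with hlt | hge
  · -- at most one paying set: `≤ 5/9`
    calc ∑ B ∈ Pay, wE M B S ≤ ∑ B ∈ Pay, (5 / 9 : ℚ) := by
          apply Finset.sum_le_sum
          intro B hB
          obtain ⟨hBq, _, hBc, _⟩ := hfat B hB
          exact wE_fat_le_five_ninths hR h5R hBq hBc S
      _ = (Pay.card : ℚ) * (5 / 9) := by rw [Finset.sum_const, nsmul_eq_mul]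
      _ ≤ 1 := by
          have : (Pay.card : ℚ) ≤ 1 := by exact_mod_cast (show Pay.card ≤ 1 by omega)
          nlinarith
  · -- exactly two paying sets, `≤ 1/2` each
    have h2 : Pay.card = 2 := by omega
    obtain ⟨B, B', hBB', hPeq⟩ := Finset.card_eq_two.1 h2
    have hBm : B ∈ Pay := by rw [hPeq]; exact Finset.mem_insert_self _ _
    have hB'm : B' ∈ Pay := by rw [hPeq]; exact Finset.mem_insert_of_mem (Finset.mem_singleton_self _)
    obtain ⟨hBq, hBS, hBc, hne⟩ := hfat B hBm
    obtain ⟨hB'q, hB'S, hB'c, hne'⟩ := hfat B' hB'm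
    obtain ⟨hS6, hBc3, hB'c3, hint⟩ := card_eq_three_of_two_pay hsimple hS h6 hBq hB'q hBS hB'S hBc hB'c hne hne' hBB'
    have hle := wE_le_half_of_two_pay hR h5R hsimple hS hS6 hBq hB'q hBS hB'S hBc3 hB'c3 hint hne
    have hle' := wE_le_half_of_two_pay hR h5R hsimple hS hS6 hB'q hBq hB'S hBS hB'c3 hBc3
      (by rw [Finset.inter_comm]; exact hint) hne'
    rw [hPeq, Finset.sum_pair hBB']
    linarith

end CapEBig
end PercRepro
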